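import Summits.BirchSwinnertonDyer.BirchSwinnertonDyer.Theses.LeadingTerm

/-!
# Re-glue certificate for route-BirchSwinnertonDyer-LeadingTerm (strategist r1·g3, 2026-08-28)

`closes_onDeficientVanishing` below is, token for token, the body of the certified `glue.lean`
(`ledger route check --native --id route-BirchSwinnertonDyer-LeadingTerm --closes-file glue.lean` → verdict OK,
cone {DeficientVanishing, PinchPrime, SqueezeUBR2}); renamed and wrapped in its own namespace so that it
elaborates as a standalone workfile. To apply: take `glue.lean` (this theorem named `closes`, no import /
namespace lines) and run `ledger route edit route-BirchSwinnertonDyer-LeadingTerm --closes-file glue.lean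
--retriage asides.json …` (tenure / route-repair planner or operator; see STRATEGY-CENSUS-r1g3.md §6).
It imports ONLY the route file (every `Theorems/LeadingTerm*.lean` imports the route file, so the deciding
theorem cannot cite them — hence the inlined transport blocks T1–T3, copied from the current `closes`).
-/

namespace Summit.BirchSwinnertonDyer.BirchSwinnertonDyer.Cruxes.Consistency.ReGlue

open Summit.BirchSwinnertonDyer.BirchSwinnertonDyer.Theses.LeadingTerm

theorem closes_onDeficientVanishing (hDV : DeficientVanishing) (hP : PinchPrime) (hUB : SqueezeUBR2) :
    _root_.BirchSwinnertonDyer := by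
  -- (T1) the Mordell–Weil rank is an isomorphism invariant (AEC III.3.1(b); `VariableChangePoints`)
  have hMW : ∀ (W : WeierstrassCurve ℚ) (C : WeierstrassCurve.VariableChange ℚ),
      (C • W).mordellWeilRank = W.mordellWeilRank := fun W C =>
    @WeierstrassCurve.VariableChange.finrank_point_variableChange ℚ _ W C (Classical.decEq ℚ)
  -- (T2) the local Euler factor over the fraction field of a DVR is an isomorphism invariant
  have hloc : ∀ (R : Type) [CommRing R] [IsDomain R] [IsDiscreteValuationRing R]
      (K : Type) [Field K] [Algebra R K] [IsFractionRing R K]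
      (W : WeierstrassCurve K) [W.IsElliptic] (C : WeierstrassCurve.VariableChange K),
      (C • W).localEulerFactor R = W.localEulerFactor R := by
    intro R _ _ _ K _ _ _ W _ C
    obtain ⟨D, hD⟩ : ∃ D : WeierstrassCurve.VariableChange K,
        (C • W).minimal R = D • W.minimal R :=
      ⟨((C • W).exists_isMinimal R).choose * C * ((W.exists_isMinimal R).choose)⁻¹, by
        rw [WeierstrassCurve.minimal, WeierstrassCurve.minimal, mul_smul, mul_smul, inv_smul_smul]⟩
    haveI hE : (W.minimal R).IsElliptic := by rw [WeierstrassCurve.minimal]; infer_instance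
    have hΔ : (W.minimal R).Δ ≠ 0 := (W.minimal R).isUnit_Δ.ne_zero
    have hgood : ((C • W).minimal R).HasGoodReduction R ↔ (W.minimal R).HasGoodReduction R := by
      rw [WeierstrassCurve.hasGoodReduction_iff, WeierstrassCurve.hasGoodReduction_iff,
        WeierstrassCurve.valuation_Δ_eq_of_isMinimal_of_eq_smul R hD]
      exact and_congr_left' ⟨fun _ => inferInstance, fun _ => inferInstance⟩
    have hcard : Nat.card (((C • W).minimal R).reduction R).toAffine.Point =
        Nat.card ((W.minimal R).reduction R).toAffine.Point := by
      obtain ⟨E, hE⟩ := WeierstrassCurve.exists_reduction_eq_smul R hD hΔ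
      rw [hE]
      exact WeierstrassCurve.natCard_point_smul _ _
    have hpoly : (C • W).localPolynomial R = W.localPolynomial R := by
      classical
      unfold WeierstrassCurve.localPolynomial
      simp only [hgood, hcard,
        WeierstrassCurve.hasSplitMultiplicativeReduction_iff_of_isMinimal_of_eq_smul R hD hΔ,
        WeierstrassCurve.hasMultiplicativeReduction_iff_of_isMinimal_of_eq_smul R hD hΔ]
    simp only [WeierstrassCurve.localEulerFactor, WeierstrassCurve.localPowerSeries, hpoly]
  -- (T3) hence the entire L-function and the analytic rank are isomorphism invariants
  have hEL : ∀ (W : WeierstrassCurve ℚ) [W.IsElliptic] (C : WeierstrassCurve.VariableChange ℚ),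
      (C • W).entireLFunction = W.entireLFunction := by
    intro W _ C
    have hL : (C • W).LFunction = W.LFunction := by
      unfold WeierstrassCurve.LFunction
      congr 1
      funext v
      simp only [WeierstrassCurve.baseChange, ← WeierstrassCurve.map_variableChange]
      exact hloc _ _ _ _
    have hLS : (C • W).LSeries = W.LSeries := by
      funext s
      simp only [WeierstrassCurve.LSeries, hL]
    have hEC : (C • W).entireContinuations = W.entireContinuations := by
      simp only [WeierstrassCurve.entireContinuations, hLS]
    unfold WeierstrassCurve.entireLFunction
    rw [hEC, hLS]
  have hAR : ∀ (W : WeierstrassCurve ℚ) [W.IsElliptic] (C : WeierstrassCurve.VariableChange ℚ),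
      (C • W).analyticRank = W.analyticRank := by
    intro W _ C
    unfold WeierstrassCurve.analyticRank
    rw [hEL W C]
  -- main argument
  intro W hW
  haveI : W.IsElliptic := hW
  -- (UB) no excess rank: `r_MW ≤ r_an` (SqueezeUBR2)
  have hub : W.mordellWeilRank ≤ W.analyticRank := hUB W
  -- pass to a global minimal model and pinch there: PinchPrime supplies a good ordinary prime
  -- `p ≥ 5` and the newform `f` with `ord_T L_p(f, α⁻¹·(1+T)−1) = r_MW`
  obtain ⟨C, hCmin⟩ := WeierstrassCurve.hasGlobalMinimalModel_rat_holds W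
  haveI : (C • W).IsGloballyMinimal := hCmin
  obtain ⟨p, hp, h5, hord, D, hD, N, hN, f, hf, horder⟩ := hP (C • W)
  haveI : Fact p.Prime := hp
  haveI : NeZero N := hN
  -- the coefficient of `T^{r_MW}` is the leading one, hence non-zero
  have hcoeff : PowerSeries.coeff (C • W).mordellWeilRank
      (Literature.NumberTheory.EllipticCurves.padicLFunction f
        (Literature.NumberTheory.EllipticCurves.unitRoot (C • W) p : ℚ_[p])) ≠ 0 :=
    (PowerSeries.order_eq_nat.mp horder).1
  -- DeficientVanishing: were `r_MW < r_an`, that coefficient would vanish; so `r_an ≤ r_MW`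
  have hle' : (C • W).analyticRank ≤ (C • W).mordellWeilRank := by
    by_contra hlt
    push Not at hlt
    exact hcoeff (hDV (C • W) p h5 hord f hf hlt)
  have hle : W.analyticRank ≤ W.mordellWeilRank := by
    rw [← hAR W C, ← hMW W C]
    exact hle'
  exact le_antisymm hle hub

end Summit.BirchSwinnertonDyer.BirchSwinnertonDyer.Cruxes.Consistency.ReGlue
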